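import Literature.MathematicalPhysics.QuantumFieldTheory.Balaban1983to89.B9RWSums346SecondDiff
import Literature.MathematicalPhysics.QuantumFieldTheory.Balaban1983to89.B9RWSumsReadsNbr

/-!
# `Balaban1983to89.B9RWSums344InputFam` — the (3.44)∕(3.45) co-reading schema of [B9] for a model into a PRODUCT lattice (a packaged
# direction-pair family), SLICED probes, and the reading engine (the family form of `B9RWSumsReadsNbr.InputReadsNbr` ∕ `lines3445_of_hasMaj_nbr`)

T. Bałaban, *Propagators for lattice gauge theories in a background field*, Commun. Math. Phys. **99** (1985) 389–434
[`Balaban1985BackgroundPropagators`, "B9"], (3.44)–(3.45) p. 398 (*"|(∇_UG(U)∇\*_Uλ)(x)| ≤ …, x ∈ Δ(y)"*, *"‖ζ∇_UG(U)∇\*_Uλ‖_β ≤ …"*), (3.39)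
p. 397 (*"max_{μ,ν}"*: every norm of a two-direction quantity runs over ALL direction pairs), (3.40) p. 397; [4] = T. Bałaban, *Propagators and
renormalization transformations for lattice gauge theories. II*, Commun. Math. Phys. **96** (1984) 223–250 [`Balaban1984PropagatorsII`],
(2.51)–(2.52) p. 232.

statement-level skeleton of published theorems with citation tags; proofs where landed; nothing here is a claim about the
Yang–Mills mass gap

WHY THIS FILE (this seat's located point (O4′)).  `InputReadsNbr K U 𝔭 bH r blkY evY A` reads the (3.44)∕(3.45) members `K.e4`, `K.h2` of a
kernel family through ONE endomorphism `A` of the Y-lattice functions — at the leaves the one-slot model `D ∘ₗ (G ∘ₗ Dstar)`, which at the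
record's coordinate pins carries only the diagonal direction pairs (`B9CoReadingCoords.coordOpK_comp`), while def-Y's `kernelFamilyB.e4 ∕ .h2`
take `⨆ ν, ⨆ μ`.  THIS FILE states the same schema for a model `A : (V → ℝ) →ₗ (W → ℝ)` into an arbitrary output lattice W with its own
block map and its own probes `Φ β : (W → ℝ) →ₗ (Q → ℝ)` (★ `InputReadsFam`), provides the SLICED probes of a product lattice
(`sliceProbe φ : (u × P → ℝ) →ₗ (q × P → ℝ)`, probing each member of the family by φ; `sliceProbe_comp_familyOp`), the packaging of
sup ∕ probe majorants over a family (`hasMaj_familyOp` — no |P| factor: sup sizes), and the reading engine ★ `lines3445_of_hasMaj_fam`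
(LITERALLY the (3.44)∕(3.45) lines as typed, constants e^{rδ₀}·B′(ε), CL·e^{rδ₀}·B′(ε,β), as in the `Nbr` engine).  The operator-level
majorants of the direction-pair family ∇_{U,ν}G∇\*_{U,μ} are the sequel `B9RWSums344InputPair`.

HONEST SCOPE.  A hypothesis schema of definitional shape and kernel bookkeeping; nothing of [B9] asserted; NOT a node discharge; count-neutral;
nothing continuum, nothing about the mass gap.  Cell `pub-ymgap` (HUMAN RULING D-0062), Track A node N06 [B9], bundle F6 (rows 18–19), seat
`pub-ymgap-dag-n06-k` (g8), 2026-08-27.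
-/

namespace Literature.MathematicalPhysics.QuantumFieldTheory.Balaban1983to89.B9RWSums344InputFam

open Literature.MathematicalPhysics.QuantumFieldTheory.Balaban1983to89
open Finset B6RandomWalk B6RandomWalkHom B9Thm34Ext B11SectG B9Thm37AllNorms B9Thm37AllNormsInstances B9SectDL2Decay
open B9RWSums343Holder B9RWSumsReadsNbr B9RWSums346SecondDiff

noncomputable section

/-! ## §1 Sliced probes and the packaging of sup ∕ probe majorants over a family -/

section Family

variable {g : B9.Geometry} [Fintype g.Site] {R : ℝ} {H : Prop} {u v q P : Type}

/-- ★ **THE SLICED PROBE**: a probe `φ` of u-functions (a Hölder quotient functional, (3.40)) applied to each member of a family laid out on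
the product lattice `u × P`: `(sliceProbe φ g) (c, p) := φ (g (·, p)) c`. [cite: Balaban1985BackgroundPropagators, (3.40) p.397 + (3.39) p.397 («max_{μ,ν}»), dictionary] -/
def sliceProbe (φ : (u → ℝ) →ₗ[ℝ] (q → ℝ)) : (u × P → ℝ) →ₗ[ℝ] (q × P → ℝ) where
  toFun g := fun cp => φ (fun x => g (x, cp.2)) cp.1
  map_add' g g' := by
    funext cp
    have h : (fun x => (g + g') (x, cp.2)) = (fun x => g (x, cp.2)) + fun x => g' (x, cp.2) := rfl
    rw [h, map_add]
    rfl
  map_smul' c g := by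
    funext cp
    have h : (fun x => (c • g) (x, cp.2)) = c • fun x => g (x, cp.2) := rfl
    rw [h, map_smul]
    rfl

/-- `sliceProbe`, evaluated. [cite: Balaban1985BackgroundPropagators, (3.40) p.397, bookkeeping] -/
@[simp] theorem sliceProbe_apply (φ : (u → ℝ) →ₗ[ℝ] (q → ℝ)) (g' : u × P → ℝ) (c : q) (p : P) :
    sliceProbe φ g' (c, p) = φ (fun x => g' (x, p)) c := rfl

/-- ★ probing the package of a family slice-wise IS packaging the probed family: `sliceProbe φ ∘ familyOp T = familyOp (p ↦ φ ∘ T p)`.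
[cite: Balaban1985BackgroundPropagators, (3.39)–(3.40) p.397, bookkeeping] -/
theorem sliceProbe_comp_familyOp (φ : (u → ℝ) →ₗ[ℝ] (q → ℝ)) (T : P → ((v → ℝ) →ₗ[ℝ] (u → ℝ))) :
    sliceProbe φ ∘ₗ familyOp T = familyOp fun p => φ ∘ₗ T p := by
  apply LinearMap.ext
  intro f
  funext cp
  rfl

variable [Fintype u] [Fintype P]

/-- ★ **THE PACKAGE OF A FAMILY OF SUP-MAJORISED MODELS IS SUP-MAJORISED WITH THE SAME MAJORANT** (no |P| factor: the sharp-block sup size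
of the package over the fibre of y is the max over the family of the members' sizes). [cite: Balaban1985BackgroundPropagators, (3.39) p.397 («max_{μ,ν}») + (3.44) p.398; Balaban1984PropagatorsII, (2.51) p.232] -/
theorem hasMaj_familyOp {F : Type} [AddCommGroup F] [Module ℝ F] {b₁ : BlockNorm (toB6 g R H) F} (bu : u → g.Site)
    {T : P → (F →ₗ[ℝ] (u → ℝ))} {K : g.Site → g.Site → ℝ} (hK : ∀ a b, 0 ≤ K a b)
    (h : ∀ p, HasMaj b₁ (BlockNorm.ofBlocks (toB6 g R H) bu) (T p) K) :
    HasMaj b₁ (BlockNorm.ofBlocks (toB6 g R H) (bu ∘ Prod.fst))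
      ({ toFun := fun f xp => T xp.2 f xp.1,
         map_add' := fun f f' => by funext xp; simp only [map_add, Pi.add_apply],
         map_smul' := fun c f => by funext xp; simp only [map_smul, Pi.smul_apply, smul_eq_mul, RingHom.id_apply] } :
        F →ₗ[ℝ] (u × P → ℝ)) K := by
  classical
  intro y' μ hμ y
  have hB : 0 ≤ K y y' * b₁.loc y' μ := mul_nonneg (hK y y') (b₁.loc_nonneg _ _)
  show (⨆ xp : u × P, if bu xp.1 = y then |T xp.2 μ xp.1| else 0) ≤ K y y' * b₁.loc y' μ
  by_cases hX : Nonempty (u × P)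
  · refine ciSup_le fun xp => ?_
    split_ifs with hx
    · exact (abs_apply_le_ofBlocks_loc (G := toB6 g R H) bu y (T xp.2 μ) xp.1 hx).trans (h xp.2 y' μ hμ y)
    · exact hB
  · rw [not_nonempty_iff] at hX
    simp only [iSup_of_empty', Real.sSup_empty]
    exact hB

/-- the same for `familyOp` of models of lattice functions (`F = v → ℝ`). [cite: Balaban1985BackgroundPropagators, (3.39) p.397 + (3.44) p.398] -/
theorem hasMaj_familyOp' {b₁ : BlockNorm (toB6 g R H) (v → ℝ)} (bu : u → g.Site)
    {T : P → ((v → ℝ) →ₗ[ℝ] (u → ℝ))} {K : g.Site → g.Site → ℝ} (hK : ∀ a b, 0 ≤ K a b)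
    (h : ∀ p, HasMaj b₁ (BlockNorm.ofBlocks (toB6 g R H) bu) (T p) K) :
    HasMaj b₁ (BlockNorm.ofBlocks (toB6 g R H) (bu ∘ Prod.fst)) (familyOp T) K :=
  hasMaj_familyOp bu hK h

end Family

/-! ## §2 The schema: co-reading of `K.e4`, `K.h2` by a model into an arbitrary output lattice, observation within distance r -/

section Schema

variable {g : B9.Geometry} [Fintype g.Site] {R : ℝ} {H : Prop} {B : B9.Backgrounds}
variable {V W Q : Type}

/-- ★ **CO-READING OF THE INPUT-HÖLDER QUANTITIES `K.e4` ((3.44)) AND `K.h2` ((3.45)) BY A MODEL INTO AN ARBITRARY OUTPUT LATTICE —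
OBSERVATION WITHIN DISTANCE r OF y** (the family form of `B9RWSumsReadsNbr.InputReadsNbr`: input functions on V read through the block-norm
letter `bH ε`, output on W with block map `blkW`, probes `Φ β : (W → ℝ) → (Q → ℝ)` anchored by `blkQ`): `isLoc`∕`loc_le` — supp λ ⊂ Δ̃(y′)
⇒ the evaluation is localised at y′ in `bH ε` with size ≦ ‖λ‖_ε + |λ|; `obs4` — e4(U, λ, y) ≦ c whenever |A(ev λ)| ≦ c at every output point
within distance r of y; `obs5` — for `cutInT ζ y`: h2(U, λ, β, ζ) ≦ c·cutH whenever every probe anchored within distance r of y is ≦ c on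
A(ev λ).  A HYPOTHESIS SCHEMA; nothing asserted. [cite: Balaban1985BackgroundPropagators, (3.44)–(3.45) p.398 + (3.39)–(3.40) p.397] -/
structure InputReadsFam [Fintype W] (K : B9.KernelFamily g B) (U : B.Cfg) (bH : ℝ → BlockNorm (toB6 g R H) (V → ℝ)) (r : ℝ)
    (blkW : W → g.Site) (blkQ : Q → g.Site) (Φ : ℝ → ((W → ℝ) →ₗ[ℝ] (Q → ℝ))) (ev : g.Loc → V → ℝ)
    (A : (V → ℝ) →ₗ[ℝ] (W → ℝ)) : Prop where
  isLoc : ∀ (ε : ℝ) (lam : g.Loc) (y' : g.Site), g.suppInT lam y' → (bH ε).IsLoc y' (ev lam)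
  loc_le : ∀ (ε : ℝ) (lam : g.Loc) (y' : g.Site), g.suppInT lam y' → (bH ε).loc y' (ev lam) ≤ g.holder ε lam + g.supNorm lam
  hs_nonneg : ∀ (ε : ℝ) (lam : g.Loc), 0 ≤ g.holder ε lam + g.supNorm lam
  cutH_nonneg : ∀ (β : ℝ) (ζ : g.Cut), 0 ≤ g.cutH β ζ
  obs4 : ∀ (lam : g.Loc) (y : g.Site) (c : ℝ), 0 ≤ c → (∀ w : W, g.dist (blkW w) y ≤ r → |A (ev lam) w| ≤ c) → K.e4 U lam y ≤ c
  obs5 : ∀ (lam : g.Loc) (β : ℝ) (ζ : g.Cut) (y : g.Site) (c : ℝ), 0 ≤ c → g.cutInT ζ y →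
    (∀ p : Q, g.dist (blkQ p) y ≤ r → |Φ β (A (ev lam)) p| ≤ c) → K.h2 U lam β ζ ≤ c * g.cutH β ζ

end Schema

/-! ## §3 The reading engine: the (3.44)∕(3.45) lines AS TYPED from block-norm majorants of the model and of the probed model -/

section Engine

variable {g : B9.Geometry} [Fintype g.Site] {R : ℝ} {H : Prop} {B : B9.Backgrounds}
variable {V W Q : Type}

/-- ★ **THE (3.44)∕(3.45) MEMBERS AS TYPED, FAMILY READING.**  If A has, from `bH ε` into the sharp blocks of W, the majorant B′(ε)·e^{−δ₀d}
(0 < ε ≦ 1), and the probed model `Φ β ∘ A` has, from `bH (β+ε)` into the sharp blocks of the probe anchors, the majorant B′(ε,β)·(Lʲη)^{−β}·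
e^{−δ₀d} (0 ≦ β < 1), and `K.e4`, `K.h2` are co-read by A (observation radius r, level comparability CL on distance ≦ r, d a symmetric
semi-metric with the triangle inequality, 0 ≦ δ₀), then for supp λ ⊂ Δ̃(y′): e4(U, λ, y) ≦ e^{rδ₀}B′(ε)·e^{−δ₀d(y,y′)}(‖λ‖_ε + |λ|) and, for
ζ ∈ C₀^∞(Δ̃(y)), h2(U, λ, β, ζ) ≦ CL·e^{rδ₀}B′(ε,β)·(Lʲη)^{−β}·cutH·e^{−δ₀d(y,y′)}(‖λ‖_{β+ε} + |λ|).
[cite: Balaban1985BackgroundPropagators, (3.44)–(3.45) p.398; Balaban1984PropagatorsII, (2.51)–(2.52) p.232] -/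
theorem lines3445_of_hasMaj_fam [Fintype W] [Fintype Q] {K : B9.KernelFamily g B} {U : B.Cfg}
    {bH : ℝ → BlockNorm (toB6 g R H) (V → ℝ)} {r : ℝ} {blkW : W → g.Site} {blkQ : Q → g.Site}
    {Φ : ℝ → ((W → ℝ) →ₗ[ℝ] (Q → ℝ))} {ev : g.Loc → V → ℝ} {A : (V → ℝ) →ₗ[ℝ] (W → ℝ)}
    (hR : InputReadsFam K U bH r blkW blkQ Φ ev A)
    {CL : ℝ} (hCL1 : 1 ≤ CL) (hCL : ∀ a a' : g.Site, g.dist a a' ≤ r → g.len a ≤ CL * g.len a')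
    (htri : ∀ a b c : g.Site, g.dist a c ≤ g.dist a b + g.dist b c) (hdsymm : ∀ a b : g.Site, g.dist a b = g.dist b a)
    {Bε : ℝ → ℝ} {Bεβ : ℝ → ℝ → ℝ} {δ₀ : ℝ}
    (hBε : ∀ ε, 0 < ε → ε ≤ 1 → 0 ≤ Bε ε) (hBεβ : ∀ ε β, 0 < ε → ε ≤ 1 → 0 ≤ β → β < 1 → 0 ≤ Bεβ ε β)
    (hδ₀ : 0 ≤ δ₀) (hlen : ∀ y : g.Site, 0 < g.len y)
    (h44 : ∀ ε, 0 < ε → ε ≤ 1 → HasMaj (bH ε) (BlockNorm.ofBlocks (toB6 g R H) blkW) A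
      (fun (a b : g.Site) => Bε ε * Real.exp (-(δ₀ * g.dist a b))))
    (h45 : ∀ ε β, 0 < ε → ε ≤ 1 → 0 ≤ β → β < 1 →
      HasMaj (bH (β + ε)) (BlockNorm.ofBlocks (toB6 g R H) blkQ) (Φ β ∘ₗ A)
        (fun (a b : g.Site) => Bεβ ε β * g.len a ^ (-β) * Real.exp (-(δ₀ * g.dist a b)))) :
    (∀ (ε : ℝ) (lam : g.Loc) (y y' : g.Site), 0 < ε → ε ≤ 1 → g.suppInT lam y' →
        K.e4 U lam y ≤ (Real.exp (r * δ₀) * Bε ε) * Real.exp (-(δ₀ * g.dist y y')) * (g.holder ε lam + g.supNorm lam)) ∧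
      (∀ (ε β : ℝ) (lam : g.Loc) (ζ : g.Cut) (y y' : g.Site), 0 < ε → ε ≤ 1 → 0 ≤ β → β < 1 →
        g.cutInT ζ y → g.suppInT lam y' →
        K.h2 U lam β ζ ≤ (CL * Real.exp (r * δ₀) * Bεβ ε β) * (g.len y) ^ (-β) * g.cutH β ζ *
          Real.exp (-(δ₀ * g.dist y y')) * (g.holder (β + ε) lam + g.supNorm lam)) := by
  -- adapted from `B9RWSumsReadsNbr.lines3445_of_hasMaj_nbr` (one-slot model; same arithmetic)
  refine ⟨fun ε lam y y' hε0 hε1 hs => ?_, fun ε β lam ζ y y' hε0 hε1 hβ0 hβ1 hζ hs => ?_⟩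
  · have hK : 0 ≤ (Real.exp (r * δ₀) * Bε ε) * Real.exp (-(δ₀ * g.dist y y')) :=
      mul_nonneg (mul_nonneg (Real.exp_nonneg _) (hBε ε hε0 hε1)) (Real.exp_nonneg _)
    have hc : 0 ≤ (Real.exp (r * δ₀) * Bε ε) * Real.exp (-(δ₀ * g.dist y y')) * (g.holder ε lam + g.supNorm lam) :=
      mul_nonneg hK (hR.hs_nonneg ε lam)
    refine hR.obs4 lam y _ hc fun w hw => ?_
    have hb : (BlockNorm.ofBlocks (toB6 g R H) blkW).loc (blkW w) (A (ev lam)) ≤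
        Bε ε * Real.exp (-(δ₀ * g.dist (blkW w) y')) * (bH ε).loc y' (ev lam) :=
      h44 ε hε0 hε1 y' (ev lam) (hR.isLoc ε lam y' hs) (blkW w)
    have hpt := abs_apply_le_ofBlocks_loc (G := toB6 g R H) blkW (blkW w) (A (ev lam)) w rfl
    have h2 : Real.exp (-(δ₀ * g.dist (blkW w) y')) ≤ Real.exp (r * δ₀) * Real.exp (-(δ₀ * g.dist y y')) :=
      exp_shift_of_dist_le hδ₀ htri hdsymm hw y'
    have h3 : Bε ε * Real.exp (-(δ₀ * g.dist (blkW w) y')) ≤ (Real.exp (r * δ₀) * Bε ε) * Real.exp (-(δ₀ * g.dist y y')) := by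
      calc Bε ε * Real.exp (-(δ₀ * g.dist (blkW w) y')) ≤ Bε ε * (Real.exp (r * δ₀) * Real.exp (-(δ₀ * g.dist y y'))) :=
            mul_le_mul_of_nonneg_left h2 (hBε ε hε0 hε1)
        _ = (Real.exp (r * δ₀) * Bε ε) * Real.exp (-(δ₀ * g.dist y y')) := by ring
    have hloc0 : 0 ≤ (bH ε).loc y' (ev lam) := (bH ε).loc_nonneg _ _
    exact hpt.trans (hb.trans ((mul_le_mul_of_nonneg_right h3 hloc0).trans
      (mul_le_mul_of_nonneg_left (hR.loc_le ε lam y' hs) hK)))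
  · have hK : 0 ≤ (CL * Real.exp (r * δ₀) * Bεβ ε β) * g.len y ^ (-β) * Real.exp (-(δ₀ * g.dist y y')) :=
      mul_nonneg (mul_nonneg (mul_nonneg (mul_nonneg (zero_le_one.trans hCL1) (Real.exp_nonneg _))
        (hBεβ ε β hε0 hε1 hβ0 hβ1)) (Real.rpow_nonneg (hlen y).le _)) (Real.exp_nonneg _)
    have hc : 0 ≤ (CL * Real.exp (r * δ₀) * Bεβ ε β) * g.len y ^ (-β) * Real.exp (-(δ₀ * g.dist y y')) *
        (g.holder (β + ε) lam + g.supNorm lam) := mul_nonneg hK (hR.hs_nonneg (β + ε) lam)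
    have hobs := hR.obs5 lam β ζ y _ hc hζ fun p hp => by
      have hb : (BlockNorm.ofBlocks (toB6 g R H) blkQ).loc (blkQ p) ((Φ β ∘ₗ A) (ev lam)) ≤
          Bεβ ε β * g.len (blkQ p) ^ (-β) * Real.exp (-(δ₀ * g.dist (blkQ p) y')) * (bH (β + ε)).loc y' (ev lam) :=
        h45 ε β hε0 hε1 hβ0 hβ1 y' (ev lam) (hR.isLoc (β + ε) lam y' hs) (blkQ p)
      have hpt := abs_apply_le_ofBlocks_loc (G := toB6 g R H) blkQ (blkQ p) ((Φ β ∘ₗ A) (ev lam)) p rfl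
      rw [LinearMap.comp_apply] at hpt
      have hpy : g.dist y (blkQ p) ≤ r := by rw [hdsymm]; exact hp
      have h1 : g.len (blkQ p) ^ (-β) ≤ CL * g.len y ^ (-β) :=
        rpow_neg_le_of_len_le (hlen y) hCL1 (hCL y (blkQ p) hpy) hβ0 hβ1.le
      have h2 : Real.exp (-(δ₀ * g.dist (blkQ p) y')) ≤ Real.exp (r * δ₀) * Real.exp (-(δ₀ * g.dist y y')) :=
        exp_shift_of_dist_le hδ₀ htri hdsymm hp y'
      have h3 : Bεβ ε β * g.len (blkQ p) ^ (-β) * Real.exp (-(δ₀ * g.dist (blkQ p) y')) ≤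
          (CL * Real.exp (r * δ₀) * Bεβ ε β) * g.len y ^ (-β) * Real.exp (-(δ₀ * g.dist y y')) := by
        have h12 : g.len (blkQ p) ^ (-β) * Real.exp (-(δ₀ * g.dist (blkQ p) y')) ≤
            (CL * g.len y ^ (-β)) * (Real.exp (r * δ₀) * Real.exp (-(δ₀ * g.dist y y'))) :=
          mul_le_mul h1 h2 (Real.exp_nonneg _) (mul_nonneg (zero_le_one.trans hCL1) (Real.rpow_nonneg (hlen y).le _))
        calc Bεβ ε β * g.len (blkQ p) ^ (-β) * Real.exp (-(δ₀ * g.dist (blkQ p) y'))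
            = Bεβ ε β * (g.len (blkQ p) ^ (-β) * Real.exp (-(δ₀ * g.dist (blkQ p) y'))) := by ring
          _ ≤ Bεβ ε β * ((CL * g.len y ^ (-β)) * (Real.exp (r * δ₀) * Real.exp (-(δ₀ * g.dist y y')))) :=
              mul_le_mul_of_nonneg_left h12 (hBεβ ε β hε0 hε1 hβ0 hβ1)
          _ = (CL * Real.exp (r * δ₀) * Bεβ ε β) * g.len y ^ (-β) * Real.exp (-(δ₀ * g.dist y y')) := by ring
      have hloc0 : 0 ≤ (bH (β + ε)).loc y' (ev lam) := (bH (β + ε)).loc_nonneg _ _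
      exact hpt.trans (hb.trans ((mul_le_mul_of_nonneg_right h3 hloc0).trans
        (mul_le_mul_of_nonneg_left (hR.loc_le (β + ε) lam y' hs) hK)))
    exact hobs.trans (le_of_eq (by ring))

end Engine

end

end Literature.MathematicalPhysics.QuantumFieldTheory.Balaban1983to89.B9RWSums344InputFam
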